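import Mathlib.RingTheory.Finiteness.FiniteTypeLocal
import Mathlib.RingTheory.Localization.LocalizationLocalization
import Mathlib.RingTheory.Localization.AtPrime.Basic
import Mathlib.AlgebraicGeometry.Noetherian
import Literature.AlgebraicGeometry.Resolution.WeightedResolutionDatum
import Literature.AlgebraicGeometry.Resolution.CobordantBlowupRegularCentre
import Summits.ResolutionOfSingularities.ResolutionOfSingularities.Theorems.WeightedInvariantWeightedConstructionExtReesWeighted
import Summits.ResolutionOfSingularities.ResolutionOfSingularities.Theorems.WeightedInvariantWeightedConstructionExtReesLocalization
import Summits.ResolutionOfSingularities.ResolutionOfSingularities.Theorems.WeightedInvariantWeightedConstructionWeightedChartBasicOpen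

/-!
# `Γ(B(U)) = Γ(Y,U)[t⁻¹, Rₙ(U) tⁿ]` is a regular ring of finite type (Włodarczyk 2.3.9, every affine `U`)

Route `ResolutionOfSingularities/WeightedInvariant`, crux `WeightedConstruction`
(stmt-ResolutionOfSingularities-0571), line `support-first-weights-second`, stub
`stub_extReesAlgebra_regular_finiteType` (the ring core of the planner's infrastructure stub
`stub_cobordantPlus_smooth`): for a regular weighted centre `R` (Włodarczyk, arXiv:2203.03090,
Def. 2.1.10) on a scheme `Y` smooth, separated and quasi-compact over a field and ANY affine open
`U ⊆ Y` — not only the chart opens on which `R` is presented by parameters — the extended Rees algebra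
`S = Γ(Y,U)[t⁻¹, Rₙ(U) tⁿ] = extReesAlgebra (R.chartIdeals U)` of the datum file
(`Literature/AlgebraicGeometry/Resolution/WeightedResolutionDatum.lean`) is a regular ring, of finite
type over `A = Γ(Y, U)`.

Proof (local-to-global on `Spec A`): every point of `U` has a basic open neighbourhood `D(h) ⊆ U`,
`h ∈ A`, which is also a basic open of a weighted chart `U'` of `R`
(`exists_basicOpen_le_affine_inter`); over `D(h)` the pieces of `R` are the weighted monomial ideals of
the restricted parameters, so `Γ(B(D(h))) = cobordantAlgebra (u|_{D(h)}) w` is a regular ring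
(`cobordantAlgebra.isRegularRing_of_linearIndependent_toCotangent`, Włodarczyk 2.3.9) of finite type
(`cobordantAlgebra.presentation_surjective`) — `isRegularRing_finiteType_of_chart`; and it is the
localisation of `S` away from `h` (`stub_extReesAlgebra_localization`). The good `h` generate the
unit ideal of `A` (no prime contains them all), so finite type descends
(`Algebra.FiniteType.of_span_eq_top_target`) and regularity of `S` at a prime `Q` is regularity of the
regular ring `Γ(B(D(h)))`, `h ∉ Q ∩ A`, at the corresponding prime (localisation of a localisation).
-/

set_option linter.dupNamespace false -- mandated namespace of this single-conjunct summit

noncomputable section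

namespace Summit.ResolutionOfSingularities.ResolutionOfSingularities.Theorems

open CategoryTheory AlgebraicGeometry TopologicalSpace Literature.AlgebraicGeometry.Resolution
open scoped LaurentPolynomial

namespace ExtReesRegular

variable {k : Type} [Field k] {Y : Scheme.{0}} (f : Y ⟶ Spec (.of k)) [Smooth f]
  (R : ReesAlgebraData Y)

include f in
/-- **The local model.** On a basic open `V = D(h')` of a weighted chart `(U', u, w)` of `R`
(`Y` smooth over a field) the extended Rees algebra `Γ(Y,V)[t⁻¹, Rₙ(V) tⁿ]` is the cobordant algebra
of the restricted parameters, hence a regular ring (Włodarczyk 2.3.9) of finite type over `Γ(Y, V)`.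
[cite: Wlodarczyk2022, Lemma 2.3.9] -/
theorem isRegularRing_finiteType_of_chart {U' : Y.affineOpens} {m : ℕ} {u : Fin m → Γ(Y, U')}
    {w : Fin m → ℕ} (hchart : R.IsWeightedChart U' u w) (h' : Γ(Y, U')) (V : Y.affineOpens)
    (hVU : (V : Y.Opens) ≤ U') (hV : (V : Y.Opens) = Y.basicOpen h') :
    IsRegularRing (extReesAlgebra (R.chartIdeals V)) ∧
      Algebra.FiniteType Γ(Y, V) (extReesAlgebra (R.chartIdeals V)) := by
  obtain ⟨hregA, hw, hideal, hloc⟩ := stub_weightedChart_basicOpen f R U' u w hchart h' V hVU hV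
  set u'' : Fin m → Γ(Y, V) := fun i => (Y.presheaf.map (homOfLE hVU).op).hom (u i) with hu''
  have hI : R.chartIdeals V = weightedMonomialIdeal u'' w := funext hideal
  rw [hI, stub_extReesAlgebra_weighted u'' w]
  haveI := hregA
  exact ⟨cobordantAlgebra.isRegularRing_of_linearIndependent_toCotangent u'' w hw hloc,
    Algebra.FiniteType.of_surjective (cobordantAlgebra.presentation u'' w)
      (cobordantAlgebra.presentation_surjective u'' w)⟩

include f in
/-- **Good basic opens around every point.** For a regular weighted centre, every point `y` of an
affine open `U` lies in a basic open `D(h)`, `h ∈ Γ(Y, U)`, over which the extended Rees algebra is a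
regular ring of finite type. [cite: Wlodarczyk2022, Lemma 2.3.9] -/
theorem exists_basicOpen_isRegularRing (hR : R.IsRegularWeightedCentre) (U : Y.affineOpens)
    {y : Y} (hy : y ∈ (U : Y.Opens)) :
    ∃ h : Γ(Y, U), y ∈ Y.basicOpen h ∧
      IsRegularRing (extReesAlgebra (R.chartIdeals (Y.affineBasicOpen h))) ∧
      Algebra.FiniteType Γ(Y, Y.affineBasicOpen h)
        (extReesAlgebra (R.chartIdeals (Y.affineBasicOpen h))) := by
  obtain ⟨U', hyU', m, u, w, hchart⟩ := hR y
  obtain ⟨h, h', heq, hyh⟩ := exists_basicOpen_le_affine_inter U.2 U'.2 y ⟨hy, hyU'⟩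
  have hVU' : ((Y.affineBasicOpen h : Y.affineOpens) : Y.Opens) ≤ U' := by
    change Y.basicOpen h ≤ (U' : Y.Opens)
    rw [heq]
    exact Y.basicOpen_le h'
  exact ⟨h, hyh, isRegularRing_finiteType_of_chart f R hchart h' (Y.affineBasicOpen h) hVU' heq⟩

end ExtReesRegular

namespace ExtReesRegular

/-! ### Ring-level transport along `S[1/h] ≅ S'` -/

section Ring

variable {A A' : Type} [CommRing A] [CommRing A'] [Algebra A A'] (h : A) [IsLocalization.Away h A']
  (I : ℕ → Ideal A) (I' : ℕ → Ideal A') (hI' : ∀ n, I' n = (I n).map (algebraMap A A'))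

include hI' in
/-- Transport of finite type along `A[t⁻¹, Iₙtⁿ][1/h] ≅ A'[t⁻¹, I'ₙtⁿ]` (`A' = A[1/h]`,
`I'ₙ = Iₙ A'`): if the latter is of finite type over `A'` then the former is of finite type over `A`.
[folklore] -/
theorem finiteType_localization_away (hft : Algebra.FiniteType A' (extReesAlgebra I')) :
    Algebra.FiniteType A (Localization.Away (algebraMap A (extReesAlgebra I) h)) := by
  obtain ⟨ψ, hψ, hloc⟩ := stub_extReesAlgebra_localization h I I' hI'
  letI : Algebra (extReesAlgebra I) (extReesAlgebra I') := ψ.toAlgebra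
  haveI : IsLocalization.Away (algebraMap A (extReesAlgebra I) h) (extReesAlgebra I') := hloc
  let e : Localization.Away (algebraMap A (extReesAlgebra I) h) ≃ₐ[extReesAlgebra I]
      extReesAlgebra I' :=
    Localization.algEquiv (Submonoid.powers _) _
  have hcomp : ψ.comp (algebraMap A (extReesAlgebra I)) =
      (algebraMap A' (extReesAlgebra I')).comp (algebraMap A A') := by
    ext a : 1
    apply Subtype.ext
    rw [RingHom.comp_apply, RingHom.comp_apply, hψ, Subalgebra.coe_algebraMap,
      Subalgebra.coe_algebraMap, ← LaurentPolynomial.C_eq_algebraMap,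
      ← LaurentPolynomial.C_eq_algebraMap, ← LaurentPolynomial.single_eq_C,
      AddMonoidAlgebra.mapRingHom_single, LaurentPolynomial.single_eq_C]
  refine RingHom.finiteType_algebraMap.mp ?_
  rw [IsScalarTower.algebraMap_eq A (extReesAlgebra I)
    (Localization.Away (algebraMap A (extReesAlgebra I) h))]
  have he : algebraMap (extReesAlgebra I) (Localization.Away (algebraMap A (extReesAlgebra I) h)) =
      (e.symm : _ →+* _).comp ψ := by
    ext z
    change _ = e.symm (algebraMap _ (extReesAlgebra I') z)
    rw [AlgEquiv.commutes]
  rw [he, RingHom.comp_assoc, hcomp]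
  refine RingHom.FiniteType.comp (RingHom.FiniteType.of_surjective _ e.symm.surjective)
    (RingHom.FiniteType.comp ?_ ?_)
  · exact RingHom.finiteType_algebraMap.mpr hft
  · exact RingHom.finiteType_algebraMap.mpr
      (IsLocalization.finiteType_of_monoid_fg (Submonoid.powers h) _)

include hI' in
/-- Transport of regularity along `A[t⁻¹, Iₙtⁿ][1/h] ≅ A'[t⁻¹, I'ₙtⁿ]`: if the latter is a regular ring
then the former (assumed Noetherian) is regular at every prime `Q` not containing `h` (the
localisation at `Q` is a localisation of the localisation). [folklore] -/
theorem isRegularLocalRing_localization_of_not_mem [IsNoetherianRing (extReesAlgebra I)]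
    (hreg : IsRegularRing (extReesAlgebra I')) (Q : Ideal (extReesAlgebra I)) [hQ : Q.IsPrime]
    (hxQ : algebraMap A (extReesAlgebra I) h ∉ Q) :
    IsRegularLocalRing (Localization.AtPrime Q) := by
  obtain ⟨ψ, -, hloc⟩ := stub_extReesAlgebra_localization h I I' hI'
  letI : Algebra (extReesAlgebra I) (extReesAlgebra I') := ψ.toAlgebra
  haveI : IsLocalization.Away (algebraMap A (extReesAlgebra I) h) (extReesAlgebra I') := hloc
  have hdisj : Disjoint ((Submonoid.powers (algebraMap A (extReesAlgebra I) h) :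
      Set (extReesAlgebra I))) (Q : Set (extReesAlgebra I)) :=
    (Ideal.disjoint_powers_iff_notMem_of_isPrime _).mpr hxQ
  -- the extended prime `p'` and the localisation of the regular ring at it
  let p' : Ideal (extReesAlgebra I') := Q.map (algebraMap _ _)
  haveI hp' : p'.IsPrime :=
    IsLocalization.isPrime_of_isPrime_disjoint
      (Submonoid.powers (algebraMap A (extReesAlgebra I) h)) _ Q hQ hdisj
  have hunder : p'.comap (algebraMap _ _) = Q :=
    IsLocalization.under_map_of_isPrime_disjoint
      (Submonoid.powers (algebraMap A (extReesAlgebra I) h)) _ hQ hdisj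
  have hT : IsLocalization.AtPrime (Localization.AtPrime p') (p'.comap (algebraMap _ _)) :=
    IsLocalization.isLocalization_isLocalization_atPrime_isLocalization
      (Submonoid.powers (algebraMap A (extReesAlgebra I) h)) (Localization.AtPrime p') p'
  have hM : (p'.comap (algebraMap (extReesAlgebra I) _)).primeCompl = Q.primeCompl := by
    ext z
    change z ∉ p'.comap (algebraMap _ _) ↔ z ∉ Q
    rw [hunder]
  haveI hT' : IsLocalization.AtPrime (Localization.AtPrime p') Q := by
    change IsLocalization Q.primeCompl _
    rw [← hM]
    exact hT
  haveI := hreg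
  haveI : IsRegularLocalRing (Localization.AtPrime p') :=
    IsRegularRing.isRegularLocalRing_localization p'
  exact IsRegularLocalRing.of_ringEquiv (R := Localization.AtPrime p')
    (IsLocalization.algEquiv Q.primeCompl (Localization.AtPrime p') (Localization.AtPrime Q)).toRingEquiv

end Ring

/-! ### Global: every affine open -/

variable {k : Type} [Field k] {Y : Scheme.{0}} (f : Y ⟶ Spec (.of k)) [Smooth f]
  (R : ReesAlgebraData Y)

/-- Quasi-coherence of the pieces: over `D(h)` they are the extended pieces over `U`. [folklore] -/
theorem chartIdeals_affineBasicOpen (U : Y.affineOpens) (h : Γ(Y, U)) (n : ℕ) :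
    (R.chartIdeals (Y.affineBasicOpen h) n : Ideal Γ(Y, Y.basicOpen h)) =
      (R.chartIdeals U n).map (algebraMap Γ(Y, U) Γ(Y, Y.basicOpen h)) := by
  rw [ReesAlgebraData.chartIdeals_apply, ReesAlgebraData.chartIdeals_apply,
    ← (R.piece n).map_ideal_basicOpen U h]
  rfl

omit [Field k] [Smooth f] in
/-- A good parameter `h` does not lie in the prime of `Γ(Y, U)` of a point of `D(h)`. [folklore] -/
theorem not_mem_of_mem_basicOpen (U : Y.affineOpens) (h : Γ(Y, U)) (P : Ideal Γ(Y, U))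
    [hP : P.IsPrime] (hy : U.2.fromSpec ⟨P, hP⟩ ∈ Y.basicOpen h) : h ∉ P := by
  have hmem : (⟨P, hP⟩ : Spec Γ(Y, U)) ∈ U.2.fromSpec ⁻¹ᵁ Y.basicOpen h := hy
  rw [U.2.fromSpec_preimage_basicOpen] at hmem
  exact (PrimeSpectrum.mem_basicOpen _ _).mp hmem

include f in
/-- **Finite type** of `Γ(B(U))` over `Γ(Y, U)` for every affine open `U` (finite type is local on
the target: `Algebra.FiniteType.of_span_eq_top_target`). [cite: Wlodarczyk2022, Lemma 2.3.9] -/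
theorem finiteType (hR : R.IsRegularWeightedCentre) (U : Y.affineOpens) :
    Algebra.FiniteType Γ(Y, U) (extReesAlgebra (R.chartIdeals U)) := by
  -- the good parameters generate the unit ideal
  let T : Set Γ(Y, U) := {h | IsRegularRing (extReesAlgebra (R.chartIdeals (Y.affineBasicOpen h))) ∧
      Algebra.FiniteType Γ(Y, (Y.affineBasicOpen h : Y.Opens))
        (extReesAlgebra (R.chartIdeals (Y.affineBasicOpen h)))}
  have hT : Ideal.span T = ⊤ := by
    by_contra hne
    obtain ⟨M, hM, hle⟩ := Ideal.exists_le_maximal _ hne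
    haveI := hM.isPrime
    have hy : U.2.fromSpec ⟨M, hM.isPrime⟩ ∈ (U : Y.Opens) := U.2.range_fromSpec.le ⟨_, rfl⟩
    obtain ⟨h, hyh, hreg, hft⟩ := exists_basicOpen_isRegularRing f R hR U hy
    exact not_mem_of_mem_basicOpen U h M hyh (hle (Ideal.subset_span ⟨hreg, hft⟩))
  refine Algebra.FiniteType.of_span_eq_top_target
    ((algebraMap Γ(Y, U) (extReesAlgebra (R.chartIdeals U))) '' T) ?_ ?_
  · rw [← Ideal.map_span, hT, Ideal.map_top]
  · rintro _ ⟨h, ⟨-, hft⟩, rfl⟩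
    haveI : IsLocalization.Away h Γ(Y, Y.basicOpen h) := U.2.isLocalization_basicOpen h
    exact finiteType_localization_away (A' := Γ(Y, Y.basicOpen h)) h (R.chartIdeals U)
      (R.chartIdeals (Y.affineBasicOpen h)) (chartIdeals_affineBasicOpen R U h) hft

include f in
/-- **Regularity** of `Γ(B(U))` for every affine open `U` (checked prime by prime through the good
basic opens). [cite: Wlodarczyk2022, Lemma 2.3.9] -/
theorem isRegularRing [QuasiCompact f] (hR : R.IsRegularWeightedCentre) (U : Y.affineOpens) :
    IsRegularRing (extReesAlgebra (R.chartIdeals U)) := by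
  haveI : IsLocallyNoetherian Y := LocallyOfFiniteType.isLocallyNoetherian f
  haveI : IsNoetherianRing Γ(Y, U) := IsLocallyNoetherian.component_noetherian U
  haveI := finiteType f R hR U
  haveI : IsNoetherianRing (extReesAlgebra (R.chartIdeals U)) :=
    Algebra.FiniteType.isNoetherianRing Γ(Y, U) _
  refine isRegularRing_iff.mpr fun Q hQ => ?_
  -- the point of `U` under `Q` and a good basic open around it
  haveI hP : (Q.comap (algebraMap Γ(Y, U) (extReesAlgebra (R.chartIdeals U)))).IsPrime :=
    Ideal.IsPrime.comap _
  have hy : U.2.fromSpec ⟨Q.comap (algebraMap Γ(Y, U) (extReesAlgebra (R.chartIdeals U))), hP⟩ ∈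
      (U : Y.Opens) := U.2.range_fromSpec.le ⟨_, rfl⟩
  obtain ⟨h, hyh, hreg, -⟩ := exists_basicOpen_isRegularRing f R hR U hy
  have hxQ : algebraMap Γ(Y, U) (extReesAlgebra (R.chartIdeals U)) h ∉ Q :=
    not_mem_of_mem_basicOpen U h _ hyh
  haveI : IsLocalization.Away h Γ(Y, Y.basicOpen h) := U.2.isLocalization_basicOpen h
  exact @isRegularLocalRing_localization_of_not_mem Γ(Y, U) Γ(Y, Y.basicOpen h) _ _
    (Scheme.algebra_section_section_basicOpen h) h (U.2.isLocalization_basicOpen h)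
    (R.chartIdeals U) (R.chartIdeals (Y.affineBasicOpen h)) (chartIdeals_affineBasicOpen R U h) inferInstance hreg Q
    hQ hxQ

end ExtReesRegular

open ExtReesRegular in
/-- **Stub 1′ (ring core of `stub_cobordantPlus_smooth`; Włodarczyk 2.3.9 for the datum's charts,
every affine open).** For a regular weighted centre `R` on a scheme `Y` smooth, separated and
quasi-compact over a field and ANY affine open `U`, the extended Rees algebra
`Γ(B(U)) = Γ(Y,U)[t⁻¹, Rₙ(U) tⁿ]` is a regular ring, of finite type over `Γ(Y, U)`.
[cite: Wlodarczyk2022, Lemma 2.3.9] -/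
theorem stub_extReesAlgebra_regular_finiteType :
    ∀ ⦃k : Type⦄ [Field k] ⦃Y : Scheme.{0}⦄ (f : Y ⟶ Spec (.of k))
      [Smooth f] [IsSeparated f] [QuasiCompact f] (R : ReesAlgebraData Y),
      R.IsRegularWeightedCentre → ∀ U : Y.affineOpens,
        IsRegularRing (extReesAlgebra (R.chartIdeals U)) ∧
          Algebra.FiniteType Γ(Y, U) (extReesAlgebra (R.chartIdeals U)) := by
  intro k _ Y f _ _ _ R hR U
  exact ⟨ExtReesRegular.isRegularRing f R hR U, ExtReesRegular.finiteType f R hR U⟩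

end Summit.ResolutionOfSingularities.ResolutionOfSingularities.Theorems

end
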